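import Literature.Probability.RandomPlanarGeometry.SAWTriangularConnectiveConstantLower
import HarnessLib

/-!
# `μ(𝕋) > 3.93`: the irreducible-bridge certificate of `SAWTriangularConnectiveConstantLower.lean` at length `12`

Topic `Literature/Probability/RandomPlanarGeometry` (continues `SAWTriangularConnectiveConstantLower.lean`: the
verified acceptance test `TriIrrCert.WordOK`, its soundness `TriIrrCert.mem_brickIrreducibleBridges_of_wordOK` /
`TriIrrCert.brickFun_triVerts_injOn`, the certified counts `λ_n(𝕋)` for `n ≤ 11` and `μ(𝕋) > 3.91`). One more
evaluation, `λ_12(𝕋) ≥ 129 614` (the exact value), kept in its own file because its `native_decide` is the expensive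
one, and the resulting numeral: `Σ_{n ≤ 12} λ_n(𝕋) (100/393)^n ≥ 1.0014 > 1`, hence **`μ(𝕋) > 3.93`** by the
certificate principle `inv_lt_exp_logMuTri_of_one_lt_sum` (Kesten's inequality `Σ_n λ_n μ^{-n} ≤ 1`,
Madras–Slade (4.2.3)–(4.2.4); the method of Jensen 2004 §2, whose series reach `4.118935`; ours is weaker but
kernel-checked).

The untrusted search here (`TriIrrCert.dfsSym`) halves the work of `TriIrrCert.dfs` by the height-preserving
reflection `(x, y) ↦ (x + y, −y)` of `𝕋` (on step letters: `1 ↔ 5`, `2 ↔ 4`, `0`, `3` fixed): it explores only the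
words whose first letter outside `{0, 3}` lies in `{1, 2}`, adds the mirror images, sorts and removes consecutive
duplicates; as before only the OUTPUT is checked (`TriIrrCert.certL`, soundness `TriIrrCert.le_of_certL`, standard
axioms), so the symmetry needs no proof. Computational class: axioms standard plus the `native_decide` count
certificate (`Lean.ofReduceBool`).
-/

open Finset Literature.Probability.LatticeModels Literature.Probability.Percolation SimpleGraph
open scoped BigOperators

namespace Literature.Probability.RandomPlanarGeometry.SAW

namespace TriIrrCert

/-! ### A certificate check for an arbitrary candidate list -/

/-- The certificate check on a given candidate list `L`: exactly `m` words, each accepted by `WordOK n`, strictly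
increasing in the integer encoding. [cite: Jensen2004SAWLowerBounds, §2] -/
def certL (n m : ℕ) (L : List (List TriStep)) : Bool :=
  decide (L.length = m) && L.all (fun w => decide (WordOK n w)) && decide (L.IsChain EncLT)

/-- **Soundness**: any list passing `certL n m` certifies `m ≤ λ_n(𝕋)`. [cite: Jensen2004SAWLowerBounds, §2]
[cite: MadrasSlade1993, Definition 4.2.1 (p. 89)] -/
theorem le_of_certL {n m : ℕ} {L : List (List TriStep)} (h : certL n m L = true) :
    m ≤ brickIrreducibleBridgeCount n := by
  classical
  simp only [certL, Bool.and_eq_true, decide_eq_true_eq, List.all_eq_true] at h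
  obtain ⟨⟨hlen, hall⟩, hchain⟩ := h
  have hnd : L.Nodup := nodup_of_chain hchain
  have hOK : ∀ w ∈ L.toFinset, WordOK n w := fun w hw => hall w (List.mem_toFinset.1 hw)
  calc m = L.toFinset.card := by rw [List.toFinset_card_of_nodup hnd, hlen]
    _ = (L.toFinset.image fun w => brickFun n (triVerts w)).card := by
        rw [Finset.card_image_of_injOn fun w hw w' hw' hww' =>
          brickFun_triVerts_injOn n (hOK w hw) (hOK w' hw') hww']
    _ ≤ #(brickIrreducibleBridges n) := by
        refine Finset.card_le_card fun ω hω => ?_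
        obtain ⟨w, hw, rfl⟩ := Finset.mem_image.1 hω
        exact mem_brickIrreducibleBridges_of_wordOK (hOK w hw)
    _ = brickIrreducibleBridgeCount n := rfl

/-! ### The untrusted search, halved by the reflection symmetry -/

/-- The height-preserving reflection of `𝕋` on step letters: `1 ↔ 5`, `2 ↔ 4`, `0` and `3` fixed
(`(x, y) ↦ (x + y, −y)` preserves `X = 2x + y`). Untrusted search helper. [cite: Jensen2004SAWLowerBounds, §2] -/
def mirror (d : TriStep) : TriStep := ⟨(6 - d.val) % 6, Nat.mod_lt _ (by norm_num)⟩

/-- The halved search: as `TriIrrCert.go`, with a flag `free` recording whether a letter outside `{0, 3}` has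
occurred; while `free = false` the letters `4, 5` are not tried (their subtrees are mirror images of those of
`2, 1`). Untrusted. [cite: Jensen2004SAWLowerBounds, §2] -/
def goSym :
    ℕ → Bool → List TriStep → ℤ × ℤ → List (ℤ × ℤ) → Array ℤ → List (List TriStep) → List (List TriStep)
  | 0, _, wr, _, _, hs, acc => if leafOK hs then wr.reverse :: acc else acc
  | k + 1, free, wr, p, vis, hs, acc =>
    let ext : TriStep → Bool → List (List TriStep) → List (List TriStep) := fun d free' acc' =>
      let q := TriFiniteMemory.pxy d p
      let h := hgt q
      if h ≤ 0 || vis.elem q then acc' else goSym k free' (d :: wr) q (q :: vis) (hs.push h) acc'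
    let acc₁ := if free then ext 4 true (ext 5 true acc) else acc
    ext 0 free (ext 1 true (ext 2 true (ext 3 free acc₁)))

/-- Remove consecutive duplicates of a list (untrusted helper, applied to a sorted list).
[cite: Jensen2004SAWLowerBounds, §2] -/
def dedupSorted : List (List TriStep) → List (List TriStep)
  | [] => []
  | [a] => [a]
  | a :: b :: l => if enc a = enc b then dedupSorted (b :: l) else a :: dedupSorted (b :: l)

/-- The (untrusted) list of step words of the `n`-step irreducible bridges of `𝕋`: the halved search, its mirror
images, sorted by the integer encoding, consecutive duplicates removed. [cite: Jensen2004SAWLowerBounds, §2] -/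
def dfsSym (n : ℕ) : List (List TriStep) :=
  let L := goSym n false [] (0, 0) [(0, 0)] #[0] []
  dedupSorted ((L ++ L.map (List.map mirror)).mergeSort fun a b => decide (enc a ≤ enc b))

/-! ### The evaluation at `n = 12` (computational class) -/

/-- `λ_12(𝕋) ≥ 129614`. [cite: Jensen2004SAWLowerBounds, §2] -/
theorem le_lambda_twelve : 129614 ≤ brickIrreducibleBridgeCount 12 :=
  le_of_certL (L := dfsSym 12) (by native_decide)

end TriIrrCert

/-! ### The numeral -/

open TriIrrCert in
/-- **`μ(𝕋) > 3.93`**: `393/100 < exp logMuTri`, from `Σ_{n ≤ 12} λ_n(𝕋) (100/393)^n > 1` and Kesten's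
inequality. [cite: Jensen2004SAWLowerBounds, §2 (Kesten's method; `4.118935 < μ_tri`)] [cite: Alm2005, §5.5.1]
[cite: Kesten1963SAW, §4] [cite: MadrasSlade1993, §4.2, eq. (4.2.3)–(4.2.4) (pp. 90–91)] -/
theorem exp_logMuTri_gt_393_div_100 : (393 : ℝ) / 100 < Real.exp logMuTri := by
  have hx : (0 : ℝ) < 100 / 393 := by norm_num
  have key : (1 : ℝ) < ∑ k ∈ Finset.range 13, (brickIrreducibleBridgeCount k : ℝ) * (100 / 393) ^ k := by
    have h1 : (3 : ℝ) ≤ brickIrreducibleBridgeCount 1 := by exact_mod_cast three_le_lambda_one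
    have h2 : (0 : ℝ) ≤ brickIrreducibleBridgeCount 2 := Nat.cast_nonneg _
    have h3 : (4 : ℝ) ≤ brickIrreducibleBridgeCount 3 := by exact_mod_cast four_le_lambda_three
    have h4 : (12 : ℝ) ≤ brickIrreducibleBridgeCount 4 := by exact_mod_cast le_lambda_four
    have h5 : (20 : ℝ) ≤ brickIrreducibleBridgeCount 5 := by exact_mod_cast le_lambda_five
    have h6 : (90 : ℝ) ≤ brickIrreducibleBridgeCount 6 := by exact_mod_cast le_lambda_six
    have h7 : (242 : ℝ) ≤ brickIrreducibleBridgeCount 7 := by exact_mod_cast le_lambda_seven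
    have h8 : (856 : ℝ) ≤ brickIrreducibleBridgeCount 8 := by exact_mod_cast le_lambda_eight
    have h9 : (2890 : ℝ) ≤ brickIrreducibleBridgeCount 9 := by exact_mod_cast le_lambda_nine
    have h10 : (10088 : ℝ) ≤ brickIrreducibleBridgeCount 10 := by exact_mod_cast le_lambda_ten
    have h11 : (35988 : ℝ) ≤ brickIrreducibleBridgeCount 11 := by exact_mod_cast le_lambda_eleven
    have h12 : (129614 : ℝ) ≤ brickIrreducibleBridgeCount 12 := by exact_mod_cast le_lambda_twelve
    simp only [Finset.sum_range_succ, Finset.sum_range_zero, brickIrreducibleBridgeCount_zero, Nat.cast_zero,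
      zero_mul, zero_add, pow_one]
    norm_num
    linarith [h1, h2, h3, h4, h5, h6, h7, h8, h9, h10, h11, h12]
  have := inv_lt_exp_logMuTri_of_one_lt_sum _ hx key
  rwa [inv_div] at this

/-- `log 3.93 < log μ(𝕋)`. [cite: Jensen2004SAWLowerBounds, §2] -/
theorem log_393_div_100_lt_logMuTri : Real.log ((393 : ℝ) / 100) < logMuTri := by
  have h := Real.log_lt_log (by norm_num) exp_logMuTri_gt_393_div_100
  rwa [Real.log_exp] at h

end Literature.Probability.RandomPlanarGeometry.SAW
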